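import Summits.QuantumFields.YangMills.Theorems.FluctuationComparisonRegPrIntLS2BetaConeOnCube
import Summits.QuantumFields.YangMills.Theorems.FluctuationComparisonRegPrIntLS2BetaCubeOffsetAlgebra
import Summits.QuantumFields.YangMills.Theorems.FluctuationComparisonRegPrIntLS2BetaBlockOffsetCoordinates
import HarnessLib

/-!
# S2β · D-GUARD ∕ (BG∞) — STAGE S ON A BLOCK ((L-S) of UV3-NODE §116 ADDENDUM 1, binder style per desk RULING №127; FILE 2∕2): the cone on a discrete cube
# ✓p839993 (S2) with its shell modulus ✓p840009 (S0), read through the OFFSET COORDINATES of a closed block (✓p839889), is a section of the block with the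
# prescribed data on the shell of every `(α, β, γ)`-cube, in-cube steps `≤ 12Λη + 3(π−r)∕n`, across-cube steps `≤ Λμ` (absent when `d = 3`), and the cap
# position — the stage of class 111 of the 8-colour gluing (the literal three-axis twin of px19 g25's ✓p839983 (L-I) and px5 g24's ✓p840047 (L-T))

Cell `ym3-torus` (YM ladder rung R3 = continuum `SU(2)` Yang–Mills on the three-torus at fixed lattice data — a RUNG: NOT d = 4, NOT infinite volume,
NOT a mass gap, NOT Clay).  Width seat «width 8» `ym3-torus-px8` (gen 28, toron∕flux lineage ✓p826411 → px17 (W1) ✓p837971), FREE px helper on crux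
`stmt-QuantumFields-20520` (`FluctuationComparisonRegPrIntL`; registry `Lines/semiclassical_s2beta.lean` UNTOUCHED, 0∕5); `--kind proof --supports
stmt-QuantumFields-20520 --as helper`, count-neutral, DEFINITION-FREE (0 `def`, 0 `instance`, 0 `notation`, 0 `sorry`, default heartbeats).  NAMED by px19 g25
(STATUS 2026-09-01T01:58:23Z «(L-S) «STAGE S ON A BLOCK»: YOURS … shape = the literal 3-D twin of my (L-I): filling PINNED by a displayed `hW : ∀ t, W t = …` over OFFSET
vectors; bond lemmas via ✓p839889 `read_tgt_eq`; face agreement ↦ (DESC₃); position; datum-to-datum»), template px5 g24's (L-T) (02:01:22Z).  The cube operator `Wc`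
enters as a BINDER whose law `hWc` is the body of ✓`exists_coneOnCube n … a` VERBATIM (the assembler does `obtain ⟨Wc, hWc⟩ := exists_coneOnCube n hn hr hrπ a` once
per block), and the block section `W` is PINNED by the displayed hypothesis `hW : ∀ t, W t = Wc (cube datum of t) (t α, t β, t γ)`.

WHY.  In the descent formulation (UV3-NODE §116 ADD.1) a stage-3 block (three long axes `α, β, γ` pairwise distinct, side `n`) carries, on every `(α, β, γ)`-cube
(the other offsets fixed — none when `d = 3`), the cone filling of the cube's shell data: `W t := Wc ψ_t (t α, t β, t γ)` with the CUBE DATUM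
`ψ_t (i, k, l) := φ (t|_{α↦i, β↦k, γ↦l})`.  A bond inside the block is ONE unit step of ONE offset (✓`read_tgt_eq`): an `α`-, `β`- or `γ`-step keeps `ψ_t` and moves
`(t α, t β, t γ)` (FILE 1∕2 ✓∕⧗`…CubeOffsetAlgebra`), so S2 (iii) — fed the `ℓ¹`-modulus `2η` that S0 derives from PER-BOND shell oscillation `η` — IS the in-cube bond
bound; a step in a fourth direction `δ` changes the cube, and S2 (iv) IS the across-cube ∕ datum-to-datum bound with `μ` := the data's oscillation along the `δ`-bonds
through the shell; S2 (i) IS the shell agreement ((DESC₃) of ADD.1) and S2 (ii) the cap position.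

WHAT IS PROVED (sorry-free; `Λ := (π − r)∕sin r`; «shell» of a cube = `i ≤ n ∧ k ≤ n ∧ l ≤ n ∧ (i = 0 ∨ i = n ∨ k = 0 ∨ k = n ∨ l = 0 ∨ l = n)` for
`(i, k, l) = (u α, u β, u γ)`; «`u` in the cube of `t`» = `update (update (update u α (t α)) β (t β)) γ (t γ) = t`; all hypotheses are CUBE-LOCAL — nothing is asked
of `φ` off the bond's own cube(s)).
* §2 OFFSET-LEVEL LAWS for any offset vector `t` with `t α, t β, t γ ≤ n`: `cubeCap_of_shellCap` (reader), ★ `stageS_shell_eq` (`W t = φ t` on the shell),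
  ★★ `norm_logVec_inv_stageS_le` (`‖logVec (a⁻¹·W t)‖ ≤ π − r` on the cube), `cubeModulus_of_shellSteps` (per-bond shell steps `≤ η` ⟹ S2 (iii)'s modulus `2η`, via
  FILE 1's `shellAdj_of_steps` and S0), ★★★ `dist1_stageS_steps_le` (the `α`-, `β`-, `γ`-steps: `dist1 (W t·(W (update t κ (t κ+1)))⁻¹) ≤ 12Λη + 3(π−r)∕n` from the
  shell cap + per-bond shell oscillation `η` of the cube), ★★★ `dist1_stageS_step_of_ne_le` (`δ ∉ {α, β, γ}`: `dist1 (W t·(W (update t δ (t δ+1)))⁻¹) ≤ Λ·μ` from the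
  two shells' caps and the shell-pointwise `δ`-bond oscillation `μ`).
* §3 BOND-LEVEL LAWS (sites `x : Site P j`, bonds `b : PBond P j`, offsets `t(x) κ := (x κ − (s κ : ZMod N)).val`, no-wrap `hN` as in (L-I)∕(L-T)):
  ★★★ `dist1_stageS_incube_le` (`b.dir = α ∨ b.dir = β ∨ b.dir = γ`), ★★★ `dist1_stageS_transverse_le` (`b.dir ∉ {α, β, γ}`) — by `rw [read_tgt_eq]` onto §2.

HONEST SCOPE.  Composition of landed sphere∕lattice geometry (✓p839993, ✓p840009) with offset bookkeeping (✓p839889, FILE 1∕2); no gauge field; nothing of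
Bałaban's renormalisation-group analysis is asserted or proved ([Balaban1985RegularSpaces] Lemma 1 p.79, (1.36) p.82, Thm 2 p.83 — local small gauges).  (BG∞) ∕
`hBG` is a CONJECTURE (plan §116): ✓p840037 `hBG_of_sections` reduces it to the displayed `hSec` = (L-Σ), which is OPEN (this file is one of its three stage
inputs, not (L-Σ)); GAP♯∘ (`stub_uniformFibreGapOrbit`, registry UNTOUCHED), the five registered stubs (0∕5), S2β, 20520, 19936, 19200, `YM3TorusSU2` are NOT
proved; no registered stub is closed; rung R3 — NOT d = 4, NOT infinite volume, NOT a mass gap, NOT Clay; the Yang–Mills mass gap is NOT proved.  Axioms standard.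

References: T. Bałaban, CMP **99** (1985) 75–102 [Balaban1985RegularSpaces] (Lemma 1 p.79, (1.36) p.82, Thm 2 p.83).
-/

set_option autoImplicit false

noncomputable section

namespace Summit.QuantumFields.YangMills.Theorems.FluctuationComparisonRegPrIntLS2BetaSqrtGaugeStageSBlock

open scoped Real
open Literature.MathematicalPhysics.QuantumLattice (su2Quat)
open Literature.MathematicalPhysics.QuantumFieldTheory.Balaban1983to89
open T4CubeChartGnomonic (SU2)
open T4ExpWindowSmallField (logVec)
open Summit.QuantumFields.YangMills.Theorems.FluctuationComparisonRegPrIntLS2BetaCubeShellModulus (dist1_shell_le_two_mul_l1)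
open Summit.QuantumFields.YangMills.Theorems.FluctuationComparisonRegPrIntLS2BetaCubeOffsetAlgebra
open Summit.QuantumFields.YangMills.Theorems.FluctuationComparisonRegPrIntLS2BetaBlockOffsetCoordinates (read_tgt_eq)

variable {P : Params} {j : ℕ}

section StageS

variable (φ : (Fin P.d → ℕ) → SU2) (a : SU2) (α β γ : Fin P.d) (n : ℕ) (r : ℝ)
  (Wc : (ℕ × ℕ × ℕ → SU2) → (ℕ × ℕ × ℕ → SU2))
  (hWc : ∀ ψ : ℕ × ℕ × ℕ → SU2,
      (∀ i k l, i ≤ n → k ≤ n → l ≤ n → (i = 0 ∨ i = n ∨ k = 0 ∨ k = n ∨ l = 0 ∨ l = n) →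
        ‖logVec (su2Quat (a⁻¹ * ψ (i, k, l)))‖ ≤ π - r) →
      (∀ i k l, i ≤ n → k ≤ n → l ≤ n → (i = 0 ∨ i = n ∨ k = 0 ∨ k = n ∨ l = 0 ∨ l = n) → Wc ψ (i, k, l) = ψ (i, k, l)) ∧
      (∀ i k l, i ≤ n → k ≤ n → l ≤ n → ‖logVec (su2Quat (a⁻¹ * Wc ψ (i, k, l)))‖ ≤ π - r) ∧
      (∀ lam : ℝ, 0 ≤ lam →
        (∀ p q : ℕ × ℕ × ℕ, p.1 ≤ n → p.2.1 ≤ n → p.2.2 ≤ n →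
          (p.1 = 0 ∨ p.1 = n ∨ p.2.1 = 0 ∨ p.2.1 = n ∨ p.2.2 = 0 ∨ p.2.2 = n) →
          q.1 ≤ n → q.2.1 ≤ n → q.2.2 ≤ n →
          (q.1 = 0 ∨ q.1 = n ∨ q.2.1 = 0 ∨ q.2.1 = n ∨ q.2.2 = 0 ∨ q.2.2 = n) →
          dist1 (ψ p * (ψ q)⁻¹) ≤ lam * ((Nat.dist p.1 q.1 + Nat.dist p.2.1 q.2.1 + Nat.dist p.2.2 q.2.2 : ℕ) : ℝ)) →
        (∀ i k l, i + 1 ≤ n → k ≤ n → l ≤ n →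
          dist1 (Wc ψ (i, k, l) * (Wc ψ (i + 1, k, l))⁻¹) ≤ 6 * ((π - r) / Real.sin r) * lam + 3 * (π - r) / n) ∧
        (∀ i k l, i ≤ n → k + 1 ≤ n → l ≤ n →
          dist1 (Wc ψ (i, k, l) * (Wc ψ (i, k + 1, l))⁻¹) ≤ 6 * ((π - r) / Real.sin r) * lam + 3 * (π - r) / n) ∧
        (∀ i k l, i ≤ n → k ≤ n → l + 1 ≤ n →
          dist1 (Wc ψ (i, k, l) * (Wc ψ (i, k, l + 1))⁻¹) ≤ 6 * ((π - r) / Real.sin r) * lam + 3 * (π - r) / n)) ∧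
      (∀ ψ' : ℕ × ℕ × ℕ → SU2, ∀ μ : ℝ,
        (∀ i k l, i ≤ n → k ≤ n → l ≤ n → (i = 0 ∨ i = n ∨ k = 0 ∨ k = n ∨ l = 0 ∨ l = n) →
          ‖logVec (su2Quat (a⁻¹ * ψ' (i, k, l)))‖ ≤ π - r) →
        (∀ i k l, i ≤ n → k ≤ n → l ≤ n → (i = 0 ∨ i = n ∨ k = 0 ∨ k = n ∨ l = 0 ∨ l = n) →
          dist1 (ψ (i, k, l) * (ψ' (i, k, l))⁻¹) ≤ μ) →
        ∀ i k l, i ≤ n → k ≤ n → l ≤ n → dist1 (Wc ψ (i, k, l) * (Wc ψ' (i, k, l))⁻¹) ≤ ((π - r) / Real.sin r) * μ))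
  (W : (Fin P.d → ℕ) → SU2)
  (hW : ∀ t : Fin P.d → ℕ, W t =
    Wc (fun p => φ (Function.update (Function.update (Function.update t α p.1) β p.2.1) γ p.2.2)) (t α, t β, t γ))

/-! ## §2 Offset-level laws -/

/-- The shell cap of the cube of `t`, read as the cap hypothesis of S2 for the cube datum `ψ_t`. [folklore] -/
theorem cubeCap_of_shellCap (hαβ : α ≠ β) (hαγ : α ≠ γ) (hβγ : β ≠ γ) (t : Fin P.d → ℕ)
    (hcap : ∀ u : Fin P.d → ℕ, Function.update (Function.update (Function.update u α (t α)) β (t β)) γ (t γ) = t →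
      u α ≤ n → u β ≤ n → u γ ≤ n → (u α = 0 ∨ u α = n ∨ u β = 0 ∨ u β = n ∨ u γ = 0 ∨ u γ = n) →
      ‖logVec (su2Quat (a⁻¹ * φ u))‖ ≤ π - r) :
    ∀ i k l, i ≤ n → k ≤ n → l ≤ n → (i = 0 ∨ i = n ∨ k = 0 ∨ k = n ∨ l = 0 ∨ l = n) →
      ‖logVec (su2Quat (a⁻¹ * (fun p : ℕ × ℕ × ℕ =>
        φ (Function.update (Function.update (Function.update t α p.1) β p.2.1) γ p.2.2)) (i, k, l)))‖ ≤ π - r := by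
  intro i k l hi hk hl hb
  have h := hcap (Function.update (Function.update (Function.update t α i) β k) γ l) (uuu_mem_cube t hαβ hαγ hβγ i k l)
  rw [uuu_apply_fst t hαβ hαγ, uuu_apply_snd t α hβγ, uuu_apply_thd] at h
  exact h hi hk hl hb

include hW hWc in
/-- ★ **THE SHELL AGREEMENT** ((DESC₃) of ADD.1): on the shell of its cube (`t α, t β, t γ ≤ n`, one of them `∈ {0, n}`), with the cube's shell data inside the
cap of `a`, the section is the datum: `W t = φ t` (S2 (i)). [folklore] -/
theorem stageS_shell_eq (hαβ : α ≠ β) (hαγ : α ≠ γ) (hβγ : β ≠ γ) (t : Fin P.d → ℕ) (hα : t α ≤ n) (hβ : t β ≤ n) (hγ : t γ ≤ n)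
    (hshell : t α = 0 ∨ t α = n ∨ t β = 0 ∨ t β = n ∨ t γ = 0 ∨ t γ = n)
    (hcap : ∀ u : Fin P.d → ℕ, Function.update (Function.update (Function.update u α (t α)) β (t β)) γ (t γ) = t →
      u α ≤ n → u β ≤ n → u γ ≤ n → (u α = 0 ∨ u α = n ∨ u β = 0 ∨ u β = n ∨ u γ = 0 ∨ u γ = n) →
      ‖logVec (su2Quat (a⁻¹ * φ u))‖ ≤ π - r) :
    W t = φ t := by
  rw [hW t, (hWc (fun p => φ (Function.update (Function.update (Function.update t α p.1) β p.2.1) γ p.2.2))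
    (cubeCap_of_shellCap φ a α β γ n r hαβ hαγ hβγ t hcap)).1 (t α) (t β) (t γ) hα hβ hγ hshell]
  simp only [Function.update_eq_self]

include hW hWc in
/-- ★★ **THE CAP POSITION**: everywhere on the cube of `t` (`t α, t β, t γ ≤ n`), with the cube's shell data inside the cap of `a`, the section stays inside the
cap: `‖logVec (a⁻¹·W t)‖ ≤ π − r` (S2 (ii)). [folklore] -/
theorem norm_logVec_inv_stageS_le (hαβ : α ≠ β) (hαγ : α ≠ γ) (hβγ : β ≠ γ) (t : Fin P.d → ℕ) (hα : t α ≤ n) (hβ : t β ≤ n) (hγ : t γ ≤ n)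
    (hcap : ∀ u : Fin P.d → ℕ, Function.update (Function.update (Function.update u α (t α)) β (t β)) γ (t γ) = t →
      u α ≤ n → u β ≤ n → u γ ≤ n → (u α = 0 ∨ u α = n ∨ u β = 0 ∨ u β = n ∨ u γ = 0 ∨ u γ = n) →
      ‖logVec (su2Quat (a⁻¹ * φ u))‖ ≤ π - r) :
    ‖logVec (su2Quat (a⁻¹ * W t))‖ ≤ π - r := by
  rw [hW t]
  exact (hWc (fun p => φ (Function.update (Function.update (Function.update t α p.1) β p.2.1) γ p.2.2))
    (cubeCap_of_shellCap φ a α β γ n r hαβ hαγ hβγ t hcap)).2.1 (t α) (t β) (t γ) hα hβ hγ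

/-- The per-bond shell oscillation of the cube of `t`, read as S2 (iii)'s `ℓ¹`-modulus `2η` for the cube datum (via S0 ✓`dist1_shell_le_two_mul_l1`). [folklore] -/
theorem cubeModulus_of_shellSteps (hαβ : α ≠ β) (hαγ : α ≠ γ) (hβγ : β ≠ γ) (t : Fin P.d → ℕ) {η : ℝ} (hη : 0 ≤ η)
    (hstep : ∀ u : Fin P.d → ℕ, ∀ κ : Fin P.d, (κ = α ∨ κ = β ∨ κ = γ) →
      Function.update (Function.update (Function.update u α (t α)) β (t β)) γ (t γ) = t →
      u α ≤ n → u β ≤ n → u γ ≤ n → (u α = 0 ∨ u α = n ∨ u β = 0 ∨ u β = n ∨ u γ = 0 ∨ u γ = n) →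
      Function.update u κ (u κ + 1) α ≤ n → Function.update u κ (u κ + 1) β ≤ n → Function.update u κ (u κ + 1) γ ≤ n →
      (Function.update u κ (u κ + 1) α = 0 ∨ Function.update u κ (u κ + 1) α = n ∨
        Function.update u κ (u κ + 1) β = 0 ∨ Function.update u κ (u κ + 1) β = n ∨
        Function.update u κ (u κ + 1) γ = 0 ∨ Function.update u κ (u κ + 1) γ = n) →
      dist1 (φ u * (φ (Function.update u κ (u κ + 1)))⁻¹) ≤ η) :
    ∀ p q : ℕ × ℕ × ℕ, p.1 ≤ n → p.2.1 ≤ n → p.2.2 ≤ n →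
      (p.1 = 0 ∨ p.1 = n ∨ p.2.1 = 0 ∨ p.2.1 = n ∨ p.2.2 = 0 ∨ p.2.2 = n) →
      q.1 ≤ n → q.2.1 ≤ n → q.2.2 ≤ n →
      (q.1 = 0 ∨ q.1 = n ∨ q.2.1 = 0 ∨ q.2.1 = n ∨ q.2.2 = 0 ∨ q.2.2 = n) →
      dist1 ((fun p : ℕ × ℕ × ℕ => φ (Function.update (Function.update (Function.update t α p.1) β p.2.1) γ p.2.2)) p *
        ((fun p : ℕ × ℕ × ℕ => φ (Function.update (Function.update (Function.update t α p.1) β p.2.1) γ p.2.2)) q)⁻¹) ≤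
        2 * η * ((Nat.dist p.1 q.1 + Nat.dist p.2.1 q.2.1 + Nat.dist p.2.2 q.2.2 : ℕ) : ℝ) := by
  refine dist1_shell_le_two_mul_l1 n _ hη (shellAdj_of_steps n _ (fun i k l hi hk hl hb hb' => ?_)
    (fun i k l hi hk hl hb hb' => ?_) (fun i k l hi hk hl hb hb' => ?_))
  · -- the `α`-step `(i,k,l) → (i+1,k,l)`
    have h := hstep (Function.update (Function.update (Function.update t α i) β k) γ l) α (Or.inl rfl) (uuu_mem_cube t hαβ hαγ hβγ i k l)
    rw [uuu_step_fst t hαβ hαγ, uuu_apply_fst t hαβ hαγ, uuu_apply_snd t α hβγ, uuu_apply_thd,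
      uuu_apply_fst t hαβ hαγ, uuu_apply_snd t α hβγ, uuu_apply_thd] at h
    exact h (by omega) hk hl hb hi hk hl (by omega)
  · -- the `β`-step `(i,k,l) → (i,k+1,l)`
    have h := hstep (Function.update (Function.update (Function.update t α i) β k) γ l) β (Or.inr (Or.inl rfl))
      (uuu_mem_cube t hαβ hαγ hβγ i k l)
    rw [uuu_step_snd t α hβγ, uuu_apply_fst t hαβ hαγ, uuu_apply_snd t α hβγ, uuu_apply_thd,
      uuu_apply_fst t hαβ hαγ, uuu_apply_snd t α hβγ, uuu_apply_thd] at h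
    exact h hi (by omega) hl hb hi hk hl (by omega)
  · -- the `γ`-step `(i,k,l) → (i,k,l+1)`
    have h := hstep (Function.update (Function.update (Function.update t α i) β k) γ l) γ (Or.inr (Or.inr rfl))
      (uuu_mem_cube t hαβ hαγ hβγ i k l)
    rw [uuu_step_thd t α β γ, uuu_apply_fst t hαβ hαγ, uuu_apply_snd t α hβγ, uuu_apply_thd,
      uuu_apply_fst t hαβ hαγ, uuu_apply_snd t α hβγ, uuu_apply_thd] at h
    exact h hi hk (by omega) hb hi hk hl (by omega)

include hW hWc in
/-- ★★★ **THE IN-CUBE STEPS**: for an offset vector `t` inside the cube with the stepped offset still `≤ n`, the cube's shell data inside the cap of `a` and with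
PER-BOND shell oscillation `≤ η`: the `α`-, `β`- and `γ`-steps of the section each cost `≤ 12·((π−r)∕sin r)·η + 3(π−r)∕n` (S2 (iii) at `lam := 2η`, S0).
[cite: Balaban1985RegularSpaces, Thm 2 p.83] -/
theorem dist1_stageS_steps_le (hαβ : α ≠ β) (hαγ : α ≠ γ) (hβγ : β ≠ γ) (t : Fin P.d → ℕ) (hα : t α ≤ n) (hβ : t β ≤ n) (hγ : t γ ≤ n)
    (hcap : ∀ u : Fin P.d → ℕ, Function.update (Function.update (Function.update u α (t α)) β (t β)) γ (t γ) = t →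
      u α ≤ n → u β ≤ n → u γ ≤ n → (u α = 0 ∨ u α = n ∨ u β = 0 ∨ u β = n ∨ u γ = 0 ∨ u γ = n) →
      ‖logVec (su2Quat (a⁻¹ * φ u))‖ ≤ π - r)
    {η : ℝ} (hη : 0 ≤ η)
    (hstep : ∀ u : Fin P.d → ℕ, ∀ κ : Fin P.d, (κ = α ∨ κ = β ∨ κ = γ) →
      Function.update (Function.update (Function.update u α (t α)) β (t β)) γ (t γ) = t →
      u α ≤ n → u β ≤ n → u γ ≤ n → (u α = 0 ∨ u α = n ∨ u β = 0 ∨ u β = n ∨ u γ = 0 ∨ u γ = n) →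
      Function.update u κ (u κ + 1) α ≤ n → Function.update u κ (u κ + 1) β ≤ n → Function.update u κ (u κ + 1) γ ≤ n →
      (Function.update u κ (u κ + 1) α = 0 ∨ Function.update u κ (u κ + 1) α = n ∨
        Function.update u κ (u κ + 1) β = 0 ∨ Function.update u κ (u κ + 1) β = n ∨
        Function.update u κ (u κ + 1) γ = 0 ∨ Function.update u κ (u κ + 1) γ = n) →
      dist1 (φ u * (φ (Function.update u κ (u κ + 1)))⁻¹) ≤ η) :
    (t α + 1 ≤ n → dist1 (W t * (W (Function.update t α (t α + 1)))⁻¹) ≤ 12 * ((π - r) / Real.sin r) * η + 3 * (π - r) / n) ∧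
    (t β + 1 ≤ n → dist1 (W t * (W (Function.update t β (t β + 1)))⁻¹) ≤ 12 * ((π - r) / Real.sin r) * η + 3 * (π - r) / n) ∧
    (t γ + 1 ≤ n → dist1 (W t * (W (Function.update t γ (t γ + 1)))⁻¹) ≤ 12 * ((π - r) / Real.sin r) * η + 3 * (π - r) / n) := by
  have h := (hWc (fun p => φ (Function.update (Function.update (Function.update t α p.1) β p.2.1) γ p.2.2))
    (cubeCap_of_shellCap φ a α β γ n r hαβ hαγ hβγ t hcap)).2.2.1 (2 * η) (by positivity)
    (cubeModulus_of_shellSteps φ α β γ n hαβ hαγ hβγ t hη hstep)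
  have hc : (6 : ℝ) * ((π - r) / Real.sin r) * (2 * η) + 3 * (π - r) / n = 12 * ((π - r) / Real.sin r) * η + 3 * (π - r) / n := by ring
  refine ⟨fun hα1 => ?_, fun hβ1 => ?_, fun hγ1 => ?_⟩
  · rw [hW t, hW (Function.update t α (t α + 1)), cube_step_fst φ t α β γ, Function.update_self,
      Function.update_of_ne (Ne.symm hαβ), Function.update_of_ne (Ne.symm hαγ), ← hc]
    exact h.1 (t α) (t β) (t γ) hα1 hβ hγ
  · rw [hW t, hW (Function.update t β (t β + 1)), cube_step_snd φ t γ hαβ, Function.update_self,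
      Function.update_of_ne hαβ, Function.update_of_ne (Ne.symm hβγ), ← hc]
    exact h.2.1 (t α) (t β) (t γ) hα hβ1 hγ
  · rw [hW t, hW (Function.update t γ (t γ + 1)), cube_step_thd φ t hαγ hβγ, Function.update_self,
      Function.update_of_ne hαγ, Function.update_of_ne hβγ, ← hc]
    exact h.2.2 (t α) (t β) (t γ) hα hβ hγ1

include hW hWc in
/-- ★★★ **THE ACROSS-CUBE STEP** (vacuous in `d = 3`, kept for the generic block algebra): for a direction `δ ∉ {α, β, γ}` and an offset vector `t` with
`t α, t β, t γ ≤ n`, with the shell data of BOTH cubes (`t` and `update t δ (t δ + 1)`) inside the cap of `a` and the data's `δ`-bonds through the shell of `t`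
of oscillation `≤ μ`: `dist1 (W t·(W (update t δ (t δ + 1)))⁻¹) ≤ ((π−r)∕sin r)·μ` (S2 (iv)). [cite: Balaban1985RegularSpaces, Thm 2 p.83] -/
theorem dist1_stageS_step_of_ne_le (hαβ : α ≠ β) (hαγ : α ≠ γ) (hβγ : β ≠ γ) {δ : Fin P.d} (hδα : δ ≠ α) (hδβ : δ ≠ β) (hδγ : δ ≠ γ)
    (t : Fin P.d → ℕ) (hα : t α ≤ n) (hβ : t β ≤ n) (hγ : t γ ≤ n)
    (hcap : ∀ u : Fin P.d → ℕ, Function.update (Function.update (Function.update u α (t α)) β (t β)) γ (t γ) = t →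
      u α ≤ n → u β ≤ n → u γ ≤ n → (u α = 0 ∨ u α = n ∨ u β = 0 ∨ u β = n ∨ u γ = 0 ∨ u γ = n) →
      ‖logVec (su2Quat (a⁻¹ * φ u))‖ ≤ π - r)
    (hcap' : ∀ u : Fin P.d → ℕ, Function.update (Function.update (Function.update u α (t α)) β (t β)) γ (t γ) = Function.update t δ (t δ + 1) →
      u α ≤ n → u β ≤ n → u γ ≤ n → (u α = 0 ∨ u α = n ∨ u β = 0 ∨ u β = n ∨ u γ = 0 ∨ u γ = n) →
      ‖logVec (su2Quat (a⁻¹ * φ u))‖ ≤ π - r)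
    {μ : ℝ}
    (hclose : ∀ u : Fin P.d → ℕ, Function.update (Function.update (Function.update u α (t α)) β (t β)) γ (t γ) = t →
      u α ≤ n → u β ≤ n → u γ ≤ n → (u α = 0 ∨ u α = n ∨ u β = 0 ∨ u β = n ∨ u γ = 0 ∨ u γ = n) →
      dist1 (φ u * (φ (Function.update u δ (u δ + 1)))⁻¹) ≤ μ) :
    dist1 (W t * (W (Function.update t δ (t δ + 1)))⁻¹) ≤ ((π - r) / Real.sin r) * μ := by
  rw [hW t, hW (Function.update t δ (t δ + 1)), Function.update_of_ne (Ne.symm hδα), Function.update_of_ne (Ne.symm hδβ),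
    Function.update_of_ne (Ne.symm hδγ)]
  have hcapψ' : ∀ i k l, i ≤ n → k ≤ n → l ≤ n → (i = 0 ∨ i = n ∨ k = 0 ∨ k = n ∨ l = 0 ∨ l = n) →
      ‖logVec (su2Quat (a⁻¹ * (fun p : ℕ × ℕ × ℕ =>
        φ (Function.update (Function.update (Function.update (Function.update t δ (t δ + 1)) α p.1) β p.2.1) γ p.2.2)) (i, k, l)))‖ ≤ π - r := by
    have hα' : Function.update t δ (t δ + 1) α = t α := Function.update_of_ne (Ne.symm hδα) ..
    have hβ' : Function.update t δ (t δ + 1) β = t β := Function.update_of_ne (Ne.symm hδβ) ..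
    have hγ' : Function.update t δ (t δ + 1) γ = t γ := Function.update_of_ne (Ne.symm hδγ) ..
    exact cubeCap_of_shellCap φ a α β γ n r hαβ hαγ hβγ (Function.update t δ (t δ + 1)) (by rw [hα', hβ', hγ']; exact hcap')
  refine (hWc (fun p => φ (Function.update (Function.update (Function.update t α p.1) β p.2.1) γ p.2.2))
    (cubeCap_of_shellCap φ a α β γ n r hαβ hαγ hβγ t hcap)).2.2.2
    (fun p : ℕ × ℕ × ℕ => φ (Function.update (Function.update (Function.update (Function.update t δ (t δ + 1)) α p.1) β p.2.1) γ p.2.2))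
    μ hcapψ' (fun i k l hi hk hl hb => ?_) (t α) (t β) (t γ) hα hβ hγ
  have h := hclose (Function.update (Function.update (Function.update t α i) β k) γ l) (uuu_mem_cube t hαβ hαγ hβγ i k l)
  rw [uuu_apply_fst t hαβ hαγ, uuu_apply_snd t α hβγ, uuu_apply_thd, uuu_apply_of_ne t hδα hδβ hδγ,
    uuu_step_of_ne t hδα hδβ hδγ] at h
  exact h hi hk hl hb

/-! ## §3 Bond-level laws (sites, bonds, offsets as in (L-I)∕(L-T)) -/

variable (s : Fin P.d → ℕ)

include hW hWc in
/-- ★★★ **THE IN-CUBE BOND STEP**: along a bond `b` in direction `α`, `β` or `γ` inside the cube of its source (source offsets `t ≤ n`, target offset `≤ n`, no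
wrap), with the cube's shell data inside the cap of `a` and of per-bond oscillation `≤ η`: `dist1 (W (t src)·(W (t tgt))⁻¹) ≤ 12·((π−r)∕sin r)·η + 3(π−r)∕n`.
[cite: Balaban1985RegularSpaces, Thm 2 p.83] -/
theorem dist1_stageS_incube_le (hαβ : α ≠ β) (hαγ : α ≠ γ) (hβγ : β ≠ γ) (b : PBond P j) (hdir : b.dir = α ∨ b.dir = β ∨ b.dir = γ)
    (hN : (b.src b.dir - ((s b.dir : ℕ) : ZMod (P.sitesPerDir j))).val + 1 < P.sitesPerDir j)
    (hα : (b.src α - ((s α : ℕ) : ZMod (P.sitesPerDir j))).val ≤ n) (hβ : (b.src β - ((s β : ℕ) : ZMod (P.sitesPerDir j))).val ≤ n)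
    (hγ : (b.src γ - ((s γ : ℕ) : ZMod (P.sitesPerDir j))).val ≤ n)
    (htgt : (b.src b.dir - ((s b.dir : ℕ) : ZMod (P.sitesPerDir j))).val + 1 ≤ n)
    (hcap : ∀ u : Fin P.d → ℕ,
      Function.update (Function.update (Function.update u α ((b.src α - ((s α : ℕ) : ZMod (P.sitesPerDir j))).val))
          β ((b.src β - ((s β : ℕ) : ZMod (P.sitesPerDir j))).val)) γ ((b.src γ - ((s γ : ℕ) : ZMod (P.sitesPerDir j))).val)
        = (fun κ => (b.src κ - ((s κ : ℕ) : ZMod (P.sitesPerDir j))).val) →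
      u α ≤ n → u β ≤ n → u γ ≤ n → (u α = 0 ∨ u α = n ∨ u β = 0 ∨ u β = n ∨ u γ = 0 ∨ u γ = n) →
      ‖logVec (su2Quat (a⁻¹ * φ u))‖ ≤ π - r)
    {η : ℝ} (hη : 0 ≤ η)
    (hstep : ∀ u : Fin P.d → ℕ, ∀ κ : Fin P.d, (κ = α ∨ κ = β ∨ κ = γ) →
      Function.update (Function.update (Function.update u α ((b.src α - ((s α : ℕ) : ZMod (P.sitesPerDir j))).val))
          β ((b.src β - ((s β : ℕ) : ZMod (P.sitesPerDir j))).val)) γ ((b.src γ - ((s γ : ℕ) : ZMod (P.sitesPerDir j))).val)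
        = (fun κ => (b.src κ - ((s κ : ℕ) : ZMod (P.sitesPerDir j))).val) →
      u α ≤ n → u β ≤ n → u γ ≤ n → (u α = 0 ∨ u α = n ∨ u β = 0 ∨ u β = n ∨ u γ = 0 ∨ u γ = n) →
      Function.update u κ (u κ + 1) α ≤ n → Function.update u κ (u κ + 1) β ≤ n → Function.update u κ (u κ + 1) γ ≤ n →
      (Function.update u κ (u κ + 1) α = 0 ∨ Function.update u κ (u κ + 1) α = n ∨
        Function.update u κ (u κ + 1) β = 0 ∨ Function.update u κ (u κ + 1) β = n ∨
        Function.update u κ (u κ + 1) γ = 0 ∨ Function.update u κ (u κ + 1) γ = n) →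
      dist1 (φ u * (φ (Function.update u κ (u κ + 1)))⁻¹) ≤ η) :
    dist1 (W (fun κ => (b.src κ - ((s κ : ℕ) : ZMod (P.sitesPerDir j))).val) *
      (W (fun κ => (b.tgt κ - ((s κ : ℕ) : ZMod (P.sitesPerDir j))).val))⁻¹) ≤ 12 * ((π - r) / Real.sin r) * η + 3 * (π - r) / n := by
  rw [read_tgt_eq W s b hN]
  set t : Fin P.d → ℕ := fun κ => (b.src κ - ((s κ : ℕ) : ZMod (P.sitesPerDir j))).val with ht
  have h := dist1_stageS_steps_le φ a α β γ n r Wc hWc W hW hαβ hαγ hβγ t hα hβ hγ hcap hη hstep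
  rcases hdir with hdir | hdir | hdir
  · rw [hdir] at htgt ⊢; exact h.1 htgt
  · rw [hdir] at htgt ⊢; exact h.2.1 htgt
  · rw [hdir] at htgt ⊢; exact h.2.2 htgt

include hW hWc in
/-- ★★★ **THE TRANSVERSE BOND STEP** (vacuous in `d = 3`): along a bond `b` in a direction `∉ {α, β, γ}` (source offsets `t` with `t α, t β, t γ ≤ n`, no wrap),
with the shell data of both cubes inside the cap of `a` and the data's `b.dir`-bonds through the shell of oscillation `≤ μ`:
`dist1 (W (t src)·(W (t tgt))⁻¹) ≤ ((π−r)∕sin r)·μ`. [cite: Balaban1985RegularSpaces, Thm 2 p.83] -/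
theorem dist1_stageS_transverse_le (hαβ : α ≠ β) (hαγ : α ≠ γ) (hβγ : β ≠ γ) (b : PBond P j) (hδα : b.dir ≠ α) (hδβ : b.dir ≠ β) (hδγ : b.dir ≠ γ)
    (hN : (b.src b.dir - ((s b.dir : ℕ) : ZMod (P.sitesPerDir j))).val + 1 < P.sitesPerDir j)
    (hα : (b.src α - ((s α : ℕ) : ZMod (P.sitesPerDir j))).val ≤ n) (hβ : (b.src β - ((s β : ℕ) : ZMod (P.sitesPerDir j))).val ≤ n)
    (hγ : (b.src γ - ((s γ : ℕ) : ZMod (P.sitesPerDir j))).val ≤ n)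
    (hcap : ∀ u : Fin P.d → ℕ,
      Function.update (Function.update (Function.update u α ((b.src α - ((s α : ℕ) : ZMod (P.sitesPerDir j))).val))
          β ((b.src β - ((s β : ℕ) : ZMod (P.sitesPerDir j))).val)) γ ((b.src γ - ((s γ : ℕ) : ZMod (P.sitesPerDir j))).val)
        = (fun κ => (b.src κ - ((s κ : ℕ) : ZMod (P.sitesPerDir j))).val) →
      u α ≤ n → u β ≤ n → u γ ≤ n → (u α = 0 ∨ u α = n ∨ u β = 0 ∨ u β = n ∨ u γ = 0 ∨ u γ = n) →
      ‖logVec (su2Quat (a⁻¹ * φ u))‖ ≤ π - r)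
    (hcap' : ∀ u : Fin P.d → ℕ,
      Function.update (Function.update (Function.update u α ((b.src α - ((s α : ℕ) : ZMod (P.sitesPerDir j))).val))
          β ((b.src β - ((s β : ℕ) : ZMod (P.sitesPerDir j))).val)) γ ((b.src γ - ((s γ : ℕ) : ZMod (P.sitesPerDir j))).val)
        = Function.update (fun κ => (b.src κ - ((s κ : ℕ) : ZMod (P.sitesPerDir j))).val) b.dir
            ((b.src b.dir - ((s b.dir : ℕ) : ZMod (P.sitesPerDir j))).val + 1) →
      u α ≤ n → u β ≤ n → u γ ≤ n → (u α = 0 ∨ u α = n ∨ u β = 0 ∨ u β = n ∨ u γ = 0 ∨ u γ = n) →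
      ‖logVec (su2Quat (a⁻¹ * φ u))‖ ≤ π - r)
    {μ : ℝ}
    (hclose : ∀ u : Fin P.d → ℕ,
      Function.update (Function.update (Function.update u α ((b.src α - ((s α : ℕ) : ZMod (P.sitesPerDir j))).val))
          β ((b.src β - ((s β : ℕ) : ZMod (P.sitesPerDir j))).val)) γ ((b.src γ - ((s γ : ℕ) : ZMod (P.sitesPerDir j))).val)
        = (fun κ => (b.src κ - ((s κ : ℕ) : ZMod (P.sitesPerDir j))).val) →
      u α ≤ n → u β ≤ n → u γ ≤ n → (u α = 0 ∨ u α = n ∨ u β = 0 ∨ u β = n ∨ u γ = 0 ∨ u γ = n) →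
      dist1 (φ u * (φ (Function.update u b.dir (u b.dir + 1)))⁻¹) ≤ μ) :
    dist1 (W (fun κ => (b.src κ - ((s κ : ℕ) : ZMod (P.sitesPerDir j))).val) *
      (W (fun κ => (b.tgt κ - ((s κ : ℕ) : ZMod (P.sitesPerDir j))).val))⁻¹) ≤ ((π - r) / Real.sin r) * μ := by
  rw [read_tgt_eq W s b hN]
  exact dist1_stageS_step_of_ne_le φ a α β γ n r Wc hWc W hW hαβ hαγ hβγ hδα hδβ hδγ _ hα hβ hγ hcap hcap' hclose

end StageS

end Summit.QuantumFields.YangMills.Theorems.FluctuationComparisonRegPrIntLS2BetaSqrtGaugeStageSBlock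

end
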